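import Literature.Topology.FourManifolds.ToricBlowupBlowDown
import Literature.Topology.FourManifolds.GluckNeckProfiles
import HarnessLib

/-!
# Polar (blow-up) coordinates on the toric model, the blow-down radius, and the squeeze

Third file on the toric model `Ṽ = ToricBlowup.Model` of `Bl_p(S² × ℝ²)` (`ToricBlowupModel.lean`,
`ToricBlowupBlowDown.lean`). We parametrise a neighbourhood of the blown-up point `p = (N, 0)` of
`B = 𝕊 2 × ℝ²` by the disc `discB : ℝ⁴ ≅ ℂ² → B`, `(u, w) ↦ (invXi u, w)` (the point with
south-pole coordinate `ξ = u` over `w`; an open smooth embedding onto `{x ≠ S} × ℝ²`, `0 ↦ p`), and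
lift it to the model:

* `ToricBlowup.liftDisc = toModel ∘ discB : ℝ⁴ ∖ 0 → Ṽ`, which in the toric charts reads
  `(u, w) ↦ Φ₂ (u, w/u) = Φ₃ (u/w, w)` — the blow-up of `ℂ²` at the origin, restricted off the
  origin; its image together with the exceptional curve `E` is `U₂ ∪ U₃`, the complement of the
  fibre `ToricBlowup.sFibre` over the south pole;
* `ToricBlowup.bdRad : Ṽ → ℝ`, the **blow-down radius** `‖(u, w)‖` (`= ‖v‖` at `liftDisc v`, `= 0`
  on `E`);
* `ToricBlowup.squeezeM`, **the squeeze of the model**: conjugate of the radial squeeze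
  `neckSqueeze : ℝ⁴ → B(0, 1/8)` (`GluckNeckProfiles.lean`) by the polar coordinates, extended by
  the identity over `E`; in the charts `U₂`, `U₃` it is `(u, m) ↦ (u', m)`, `(k, w) ↦ (k, w')` with
  `(u', w')` the squeezed vector, so it is smooth across `E` (the squeeze is linear near `0`); an
  open partial diffeomorphism `U₂ ∪ U₃ ≅ {bdRad < 1/8} ∩ (U₂ ∪ U₃)` (`squeezePH`) fixing `E` and
  with `squeezeM (liftDisc v) = liftDisc (neckSqueeze v)`.

These are the coordinates in which the neck of the glued manifold of the dissolution theorem is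
written (`ToricBlowupNeck.lean`). Only elementary chart algebra is involved; the calculus is that
of `RadialDiffeomorph.lean` / `GluckNeckProfiles.lean`.
-/

noncomputable section

open scoped Manifold ContDiff Topology ComplexConjugate
open Set Function Metric Module Complex

namespace Literature.Topology.FourManifolds

/-- Local notation: `𝔼 n` is the model Euclidean space `EuclideanSpace ℝ (Fin n)`. -/
local notation "𝔼 " n:arg => EuclideanSpace ℝ (Fin n)

/-- Local notation: `𝕊 n` is the unit sphere in `EuclideanSpace ℝ (Fin (n + 1))`. -/
local notation "𝕊 " n:arg => (Metric.sphere (0 : EuclideanSpace ℝ (Fin (n + 1))) 1)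

namespace ToricBlowup

open SphereCoord

/-! ### `ℝ⁴` as `ℂ²` -/

/-- `ℝ⁴ → ℂ²`, `v ↦ (v₀ + i v₂, v₁ + i v₃)` (the convention of the tree's `realCoordinates 2`:
real parts first, then imaginary parts). [folklore] -/
def toC2 (v : 𝔼 4) : ℂ × ℂ := (⟨v 0, v 2⟩, ⟨v 1, v 3⟩)

/-- `ℂ² → ℝ⁴`, the inverse of `toC2`. [folklore] -/
def fromC2 (p : ℂ × ℂ) : 𝔼 4 := WithLp.toLp 2 ![p.1.re, p.2.re, p.1.im, p.2.im]

/-- Components of `toC2`. [folklore] -/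
@[simp] theorem toC2_fst_re (v : 𝔼 4) : (toC2 v).1.re = v 0 := rfl

/-- Components of `toC2`. [folklore] -/
@[simp] theorem toC2_fst_im (v : 𝔼 4) : (toC2 v).1.im = v 2 := rfl

/-- Components of `toC2`. [folklore] -/
@[simp] theorem toC2_snd_re (v : 𝔼 4) : (toC2 v).2.re = v 1 := rfl

/-- Components of `toC2`. [folklore] -/
@[simp] theorem toC2_snd_im (v : 𝔼 4) : (toC2 v).2.im = v 3 := rfl

/-- Components of `fromC2`. [folklore] -/
@[simp] theorem fromC2_apply_zero (p : ℂ × ℂ) : fromC2 p 0 = p.1.re := rfl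

/-- Components of `fromC2`. [folklore] -/
@[simp] theorem fromC2_apply_one (p : ℂ × ℂ) : fromC2 p 1 = p.2.re := rfl

/-- Components of `fromC2`. [folklore] -/
@[simp] theorem fromC2_apply_two (p : ℂ × ℂ) : fromC2 p 2 = p.1.im := rfl

/-- Components of `fromC2`. [folklore] -/
@[simp] theorem fromC2_apply_three (p : ℂ × ℂ) : fromC2 p 3 = p.2.im := rfl

/-- `toC2 (fromC2 p) = p`. [folklore] -/
@[simp] theorem toC2_fromC2 (p : ℂ × ℂ) : toC2 (fromC2 p) = p :=
  Prod.ext (Complex.ext rfl rfl) (Complex.ext rfl rfl)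

/-- `fromC2 (toC2 v) = v`. [folklore] -/
@[simp] theorem fromC2_toC2 (v : 𝔼 4) : fromC2 (toC2 v) = v := by
  ext i; fin_cases i <;> rfl

/-- `toC2` is injective. [folklore] -/
theorem toC2_injective : Injective toC2 := fun a b h => by rw [← fromC2_toC2 a, ← fromC2_toC2 b, h]

/-- `fromC2` is injective. [folklore] -/
theorem fromC2_injective : Injective fromC2 := fun a b h => by rw [← toC2_fromC2 a, ← toC2_fromC2 b, h]

/-- `‖v‖² = |u|² + |w|²` for `(u, w) = toC2 v`. [folklore] -/
theorem norm_sq_eq_normSq (v : 𝔼 4) : ‖v‖ ^ 2 = normSq (toC2 v).1 + normSq (toC2 v).2 := by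
  rw [EuclideanSpace.real_norm_sq_eq, Fin.sum_univ_four, normSq_apply, normSq_apply]
  simp only [toC2_fst_re, toC2_fst_im, toC2_snd_re, toC2_snd_im]
  ring

/-- `‖fromC2 (u, w)‖² = |u|² + |w|²`. [folklore] -/
theorem norm_fromC2_sq (p : ℂ × ℂ) : ‖fromC2 p‖ ^ 2 = normSq p.1 + normSq p.2 := by
  rw [norm_sq_eq_normSq, toC2_fromC2]

/-- `toC2 v = 0 ↔ v = 0`. [folklore] -/
theorem toC2_eq_zero_iff (v : 𝔼 4) : toC2 v = 0 ↔ v = 0 := by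
  constructor
  · intro h
    have h1 : normSq (toC2 v).1 + normSq (toC2 v).2 = 0 := by rw [h]; simp
    have : ‖v‖ ^ 2 = 0 := by rw [norm_sq_eq_normSq, h1]
    exact norm_eq_zero.1 (pow_eq_zero_iff two_ne_zero |>.1 this)
  · rintro rfl; rfl

/-- `toC2 0 = 0`. [folklore] -/
@[simp] theorem toC2_zero : toC2 0 = 0 := (toC2_eq_zero_iff 0).2 rfl

/-- `fromC2 0 = 0`. [folklore] -/
@[simp] theorem fromC2_zero : fromC2 0 = 0 := by rw [← toC2_zero, fromC2_toC2]

/-- `fromC2 p = 0 ↔ p = 0`. [folklore] -/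
theorem fromC2_eq_zero_iff (p : ℂ × ℂ) : fromC2 p = 0 ↔ p = 0 := by
  rw [← toC2_eq_zero_iff, toC2_fromC2]

/-- `toC2` is real-linear in the scalar: `toC2 (r • v) = (r u, r w)`. [folklore] -/
theorem toC2_smul (r : ℝ) (v : 𝔼 4) : toC2 (r • v) = ((r : ℂ) * (toC2 v).1, (r : ℂ) * (toC2 v).2) := by
  refine Prod.ext (Complex.ext ?_ ?_) (Complex.ext ?_ ?_) <;> simp [toC2]

/-- `toC2` is smooth (linear). [folklore] -/
theorem contDiff_toC2 : ContDiff ℝ ∞ toC2 := by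
  have h1 : ContDiff ℝ ∞ fun v : 𝔼 4 => ((v 0, v 2) : ℝ × ℝ) := by fun_prop
  have h2 : ContDiff ℝ ∞ fun v : 𝔼 4 => ((v 1, v 3) : ℝ × ℝ) := by fun_prop
  exact (Complex.equivRealProdCLM.symm.contDiff.comp h1).prodMk
    (Complex.equivRealProdCLM.symm.contDiff.comp h2)

/-- `fromC2` is smooth (linear). [folklore] -/
theorem contDiff_fromC2 : ContDiff ℝ ∞ fromC2 := by
  unfold fromC2
  apply PiLp.contDiff_toLp.comp
  rw [contDiff_pi]
  intro i
  fin_cases i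
  · exact Complex.reCLM.contDiff.comp contDiff_fst
  · exact Complex.reCLM.contDiff.comp contDiff_snd
  · exact Complex.imCLM.contDiff.comp contDiff_fst
  · exact Complex.imCLM.contDiff.comp contDiff_snd

/-- `toC2` is continuous. [folklore] -/
theorem continuous_toC2 : Continuous toC2 := contDiff_toC2.continuous

/-- `fromC2` is continuous. [folklore] -/
theorem continuous_fromC2 : Continuous fromC2 := contDiff_fromC2.continuous

/-! ### The disc at the blown-up point -/

/-- **The disc at the blown-up point**: `ℝ⁴ ≅ ℂ² → B`, `(u, w) ↦ (invXi u, w)` — the point with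
south-pole coordinate `ξ = u` over `w`; `0 ↦ p = (N, 0)`. [folklore] -/
def discB (v : 𝔼 4) : (𝕊 2) × 𝔼 2 := (invXi (toC2 v).1, planeR (toC2 v).2)

/-- The inverse of the disc, `(x, w) ↦ (ξ(x), w)` (junk over the south pole). [folklore] -/
def discBInv (b : (𝕊 2) × 𝔼 2) : 𝔼 4 := fromC2 (xi b.1, toC b.2)

/-- The centre of the disc is the blown-up point. [folklore] -/
@[simp] theorem discB_zero : discB 0 = basePt := by
  simp [discB, basePt]

/-- The disc misses the fibre over the south pole. [folklore] -/
theorem discB_fst_ne_southPole (v : 𝔼 4) : (discB v).1 ≠ southPole := invXi_ne_southPole _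

/-- `discBInv (discB v) = v`. [folklore] -/
@[simp] theorem discBInv_discB (v : 𝔼 4) : discBInv (discB v) = v := by
  simp [discB, discBInv]

/-- `discB (discBInv b) = b` off the south-pole fibre. [folklore] -/
theorem discB_discBInv {b : (𝕊 2) × 𝔼 2} (hb : b.1 ≠ southPole) : discB (discBInv b) = b := by
  obtain ⟨x, w⟩ := b
  simp [discB, discBInv, invXi_xi hb]

/-- The disc is injective. [folklore] -/
theorem discB_injective : Injective discB := fun a b h => by
  rw [← discBInv_discB a, ← discBInv_discB b, h]

/-- The range of the disc is the complement of the south-pole fibre. [folklore] -/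
theorem range_discB : range discB = {b | b.1 ≠ southPole} :=
  Subset.antisymm (by rintro _ ⟨v, rfl⟩; exact discB_fst_ne_southPole v)
    fun _ hb => ⟨_, discB_discBInv hb⟩

/-- `discB v = p` iff `v = 0`. [folklore] -/
theorem discB_eq_basePt_iff (v : 𝔼 4) : discB v = basePt ↔ v = 0 := by
  refine ⟨fun h => ?_, fun h => by rw [h, discB_zero]⟩
  have := congrArg discBInv h
  rwa [discBInv_discB, ← discB_zero, discBInv_discB] at this

/-- Coordinates of the disc: `ξ ((discB v).1) = u`. [folklore] -/
@[simp] theorem xi_discB_fst (v : 𝔼 4) : xi (discB v).1 = (toC2 v).1 := xi_invXi _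

/-- Coordinates of the disc: `toC (discB v).2 = w`. [folklore] -/
@[simp] theorem toC_discB_snd (v : 𝔼 4) : toC (discB v).2 = (toC2 v).2 := toC_planeR _

/-- `(discB v).1` is the north pole iff `u = 0`. [folklore] -/
theorem discB_fst_eq_northPole_iff (v : 𝔼 4) : (discB v).1 = northPole ↔ (toC2 v).1 = 0 :=
  invXi_eq_northPole_iff _

/-- `(discB v).2 = 0` iff `w = 0`. [folklore] -/
theorem discB_snd_eq_zero_iff (v : 𝔼 4) : (discB v).2 = 0 ↔ (toC2 v).2 = 0 := by
  rw [← toC_eq_zero_iff, toC_discB_snd]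

/-- The fibre radius is at most the disc radius: `‖(discB v).2‖ ≤ ‖v‖`. [folklore] -/
theorem norm_discB_snd_le (v : 𝔼 4) : ‖(discB v).2‖ ≤ ‖v‖ := by
  have h1 : ‖(discB v).2‖ ^ 2 = normSq (toC2 v).2 := by
    rw [← normSq_toC, toC_discB_snd]
  have h2 := norm_sq_eq_normSq v
  have h3 := normSq_nonneg (toC2 v).1
  nlinarith [norm_nonneg v, norm_nonneg (discB v).2]

/-- **The disc is smooth.** [folklore] -/
theorem contMDiff_discB : ContMDiff 𝓘(ℝ, 𝔼 4) ((𝓡 2).prod 𝓘(ℝ, 𝔼 2)) ∞ discB :=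
  (contMDiff_invXi.comp (contDiff_fst.comp contDiff_toC2).contMDiff).prodMk
    (contDiff_planeR.comp (contDiff_snd.comp contDiff_toC2)).contMDiff

/-- The disc is continuous. [folklore] -/
theorem continuous_discB : Continuous discB := contMDiff_discB.continuous

/-- **The inverse disc is smooth off the south-pole fibre.** [folklore] -/
theorem contMDiffAt_discBInv {b : (𝕊 2) × 𝔼 2} (hb : b.1 ≠ southPole) :
    ContMDiffAt ((𝓡 2).prod 𝓘(ℝ, 𝔼 2)) 𝓘(ℝ, 𝔼 4) ∞ discBInv b := by
  have h1 : ContMDiffAt ((𝓡 2).prod 𝓘(ℝ, 𝔼 2)) 𝓘(ℝ, ℂ) ∞ (fun b' : (𝕊 2) × 𝔼 2 => xi b'.1) b :=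
    (contMDiffAt_xi hb).comp b contMDiffAt_fst
  have h2 : ContMDiff ((𝓡 2).prod 𝓘(ℝ, 𝔼 2)) 𝓘(ℝ, ℂ) ∞ (fun b' : (𝕊 2) × 𝔼 2 => toC b'.2) :=
    contDiff_toC.comp_contMDiff contMDiff_snd
  exact contDiff_fromC2.comp_contMDiffAt (h1.prodMk_space h2.contMDiffAt)

/-- The inverse disc is smooth on the complement of the south-pole fibre. [folklore] -/
theorem contMDiffOn_discBInv :
    ContMDiffOn ((𝓡 2).prod 𝓘(ℝ, 𝔼 2)) 𝓘(ℝ, 𝔼 4) ∞ discBInv {b | b.1 ≠ southPole} := fun _ hb =>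
  (contMDiffAt_discBInv hb).contMDiffWithinAt

/-- The disc as an open partial homeomorphism `ℝ⁴ ≅ {x ≠ S} × ℝ²`. [folklore] -/
def discBPH : OpenPartialHomeomorph (𝔼 4) ((𝕊 2) × 𝔼 2) where
  toFun := discB
  invFun := discBInv
  source := univ
  target := {b | b.1 ≠ southPole}
  map_source' v _ := discB_fst_ne_southPole v
  map_target' _ _ := mem_univ _
  left_inv' v _ := discBInv_discB v
  right_inv' _ hb := discB_discBInv hb
  open_source := isOpen_univ
  open_target := isOpen_ne.preimage continuous_fst
  continuousOn_toFun := continuous_discB.continuousOn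
  continuousOn_invFun := contMDiffOn_discBInv.continuousOn

/-- `discBPH` acts as `discB`. [folklore] -/
@[simp] theorem discBPH_apply (v : 𝔼 4) : discBPH v = discB v := rfl

/-- Its inverse acts as `discBInv`. [folklore] -/
@[simp] theorem discBPH_symm_apply (b : (𝕊 2) × 𝔼 2) : discBPH.symm b = discBInv b := rfl

/-- Its source is everything. [folklore] -/
@[simp] theorem discBPH_source : discBPH.source = univ := rfl

/-- Its target is the complement of the south-pole fibre. [folklore] -/
@[simp] theorem discBPH_target : discBPH.target = {b : (𝕊 2) × 𝔼 2 | b.1 ≠ southPole} := rfl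

/-- `discBPH` is smooth on its source. [folklore] -/
theorem contMDiffOn_discBPH :
    ContMDiffOn 𝓘(ℝ, 𝔼 4) ((𝓡 2).prod 𝓘(ℝ, 𝔼 2)) ∞ discBPH discBPH.source :=
  contMDiff_discB.contMDiffOn

/-- `discBPH.symm` is smooth on its target. [folklore] -/
theorem contMDiffOn_discBPH_symm :
    ContMDiffOn ((𝓡 2).prod 𝓘(ℝ, 𝔼 2)) 𝓘(ℝ, 𝔼 4) ∞ discBPH.symm discBPH.target :=
  contMDiffOn_discBInv

/-- The image of an open set under the disc is open. [folklore] -/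
theorem isOpen_image_discB {s : Set (𝔼 4)} (hs : IsOpen s) : IsOpen (discB '' s) :=
  discBPH.isOpen_image_of_subset_source hs (subset_univ _)

/-! ### Polar (blow-up) coordinates -/

/-- **Polar blow-up coordinates** `ℝ⁴ ∖ 0 → Ṽ`, `v ↦ toModel (discB v)` (junk at `0`): the
blow-up of `ℂ²` at the origin restricted off the origin, read in the toric model. [folklore] -/
def liftDisc (v : 𝔼 4) : Model := toModel (discB v)

/-- `discB v ≠ p` for `v ≠ 0`. [folklore] -/
theorem discB_ne_basePt {v : 𝔼 4} (hv : v ≠ 0) : discB v ≠ basePt :=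
  (discB_eq_basePt_iff v).not.2 hv

/-- **`liftDisc` in the chart `U₂`**: `(u, w) ↦ Φ₂ (u, w/u)` for `u ≠ 0`. [folklore] -/
theorem liftDisc_eq_Φ₂ {v : 𝔼 4} (hu : (toC2 v).1 ≠ 0) :
    liftDisc v = Φ₂ ((toC2 v).1, ((toC2 v).1)⁻¹ * (toC2 v).2) := by
  have hN : (discB v).1 ≠ northPole := (discB_fst_eq_northPole_iff v).not.2 hu
  rw [liftDisc, toModel_of_ne_northPole hN, Φ₁_eq_Φ₂]
  · congr 1
    simp only [τ₁₂, discB, zeta_invXi hu, inv_inv, toC_planeR]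
  · change zeta (discB v).1 ≠ 0
    simp only [discB, zeta_invXi hu]
    exact inv_ne_zero hu

/-- **`liftDisc` in the chart `U₃`**: `(u, w) ↦ Φ₃ (u/w, w)` for `w ≠ 0`. [folklore] -/
theorem liftDisc_eq_Φ₃ {v : 𝔼 4} (hw : (toC2 v).2 ≠ 0) :
    liftDisc v = Φ₃ ((toC2 v).1 * ((toC2 v).2)⁻¹, (toC2 v).2) := by
  have hw' : (discB v).2 ≠ 0 := (discB_snd_eq_zero_iff v).not.2 hw
  rw [liftDisc, toModel_of_ne_southPole (discB_fst_ne_southPole v) hw']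
  simp

/-- `blowDown (liftDisc v) = discB v` for `v ≠ 0`. [folklore] -/
theorem blowDown_liftDisc {v : 𝔼 4} (hv : v ≠ 0) : blowDown (liftDisc v) = discB v :=
  blowDown_toModel (discB_ne_basePt hv)

/-- `liftDisc` is injective off the origin. [folklore] -/
theorem liftDisc_injOn : InjOn liftDisc {v | v ≠ 0} := fun v hv v' hv' h =>
  discB_injective (by rw [← blowDown_liftDisc hv, ← blowDown_liftDisc hv', h])

/-- `liftDisc v` is not on the exceptional curve (`v ≠ 0`). [folklore] -/
theorem liftDisc_not_mem_excep {v : 𝔼 4} (hv : v ≠ 0) : liftDisc v ∉ excep :=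
  toModel_not_mem_excep (discB_ne_basePt hv)

/-- `liftDisc` is smooth off the origin. [folklore] -/
theorem contMDiffAt_liftDisc {v : 𝔼 4} (hv : v ≠ 0) :
    ContMDiffAt 𝓘(ℝ, 𝔼 4) 𝓘(ℝ, ℂ × ℂ) ∞ liftDisc v :=
  (contMDiffAt_toModel (discB_ne_basePt hv)).comp v contMDiff_discB.contMDiffAt

/-- `liftDisc` is smooth on `ℝ⁴ ∖ 0`. [folklore] -/
theorem contMDiffOn_liftDisc : ContMDiffOn 𝓘(ℝ, 𝔼 4) 𝓘(ℝ, ℂ × ℂ) ∞ liftDisc {v | v ≠ 0} :=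
  fun _ hv => (contMDiffAt_liftDisc hv).contMDiffWithinAt

/-! ### The south-pole fibre and the blow-down radius -/

/-- **The fibre over the south pole** `{ζ = 0} × ℝ²` in the model: the complement of
`U₂ ∪ U₃`. [folklore] -/
def sFibre : Set Model := {v | (blowDown v).1 = southPole}

/-- The south-pole fibre is closed. [folklore] -/
theorem isClosed_sFibre : IsClosed sFibre :=
  isClosed_singleton.preimage (continuous_fst.comp continuous_blowDown)

/-- A point of `U₁` is on the south-pole fibre iff `z = 0`. [folklore] -/
theorem Φ₁_mem_sFibre_iff (p : ℂ × ℂ) : Φ₁ p ∈ sFibre ↔ p.1 = 0 := by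
  change (blowDown (Φ₁ p)).1 = southPole ↔ _
  rw [blowDown_Φ₁]; exact invZeta_eq_southPole_iff _

/-- Points of `U₂` are off the south-pole fibre. [folklore] -/
theorem Φ₂_not_mem_sFibre (p : ℂ × ℂ) : Φ₂ p ∉ sFibre := by
  change (blowDown (Φ₂ p)).1 ≠ southPole
  rw [blowDown_Φ₂]; exact invXi_ne_southPole _

/-- Points of `U₃` are off the south-pole fibre. [folklore] -/
theorem Φ₃_not_mem_sFibre (p : ℂ × ℂ) : Φ₃ p ∉ sFibre := by
  change (blowDown (Φ₃ p)).1 ≠ southPole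
  rw [blowDown_Φ₃]; exact invXi_ne_southPole _

/-- **`U₂ ∪ U₃` is the complement of the south-pole fibre.** [folklore] -/
theorem not_mem_sFibre_iff (v : Model) : v ∉ sFibre ↔ v ∈ range Φ₂ ∪ range Φ₃ := by
  constructor
  · intro hv
    rcases exists_Φ_eq v with ⟨p, rfl⟩ | ⟨p, rfl⟩ | ⟨p, rfl⟩
    · have hp : p.1 ≠ 0 := (Φ₁_mem_sFibre_iff p).not.1 hv
      exact Or.inl ⟨τ₁₂ p, (Φ₁_eq_Φ₂ hp).symm⟩
    · exact Or.inl ⟨p, rfl⟩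
    · exact Or.inr ⟨p, rfl⟩
  · rintro (⟨p, rfl⟩ | ⟨p, rfl⟩)
    · exact Φ₂_not_mem_sFibre p
    · exact Φ₃_not_mem_sFibre p

/-- The exceptional curve is off the south-pole fibre. [folklore] -/
theorem not_mem_sFibre_of_mem_excep {v : Model} (hv : v ∈ excep) : v ∉ sFibre := by
  change (blowDown v).1 ≠ southPole
  rw [blowDown_of_mem_excep hv]
  exact northPole_ne_southPole

/-- `liftDisc v` is off the south-pole fibre. [folklore] -/
theorem liftDisc_not_mem_sFibre {v : 𝔼 4} (hv : v ≠ 0) : liftDisc v ∉ sFibre := by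
  change (blowDown (liftDisc v)).1 ≠ southPole
  rw [blowDown_liftDisc hv]
  exact discB_fst_ne_southPole v

/-- **Every point off the south-pole fibre is on `E` or in the image of `liftDisc`**, namely
`v = liftDisc (discBInv (blowDown v))`. [folklore] -/
theorem eq_liftDisc_of_not_mem {v : Model} (hv : v ∉ sFibre) (hE : v ∉ excep) :
    liftDisc (discBInv (blowDown v)) = v ∧ discBInv (blowDown v) ≠ 0 := by
  have h1 : discB (discBInv (blowDown v)) = blowDown v := discB_discBInv hv
  refine ⟨?_, fun h0 => hE ?_⟩
  · rw [liftDisc, h1, toModel_blowDown hE]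
  · rw [← blowDown_eq_basePt_iff, ← h1, h0, discB_zero]

/-- **The blow-down radius** `‖(ξ(x), w)‖` of a point of the model with blow-down `(x, w)` (junk on
the south-pole fibre): `‖v‖` at `liftDisc v`, `0` on the exceptional curve. [folklore] -/
def bdRad (v : Model) : ℝ := ‖discBInv (blowDown v)‖

/-- `bdRad (liftDisc v) = ‖v‖`. [folklore] -/
@[simp] theorem bdRad_liftDisc {v : 𝔼 4} (hv : v ≠ 0) : bdRad (liftDisc v) = ‖v‖ := by
  rw [bdRad, blowDown_liftDisc hv, discBInv_discB]

/-- `bdRad = 0` on the exceptional curve. [folklore] -/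
theorem bdRad_of_mem_excep {v : Model} (hv : v ∈ excep) : bdRad v = 0 := by
  rw [bdRad, blowDown_of_mem_excep hv, ← discB_zero, discBInv_discB, norm_zero]

/-- Off the south-pole fibre, `bdRad v = 0` iff `v` is on the exceptional curve. [folklore] -/
theorem bdRad_eq_zero_iff {v : Model} (hv : v ∉ sFibre) : bdRad v = 0 ↔ v ∈ excep := by
  refine ⟨fun h => ?_, bdRad_of_mem_excep⟩
  by_contra hE
  obtain ⟨-, h0⟩ := eq_liftDisc_of_not_mem hv hE
  exact h0 (norm_eq_zero.1 h)

/-- `bdRad` is nonnegative. [folklore] -/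
theorem bdRad_nonneg (v : Model) : 0 ≤ bdRad v := norm_nonneg _

/-- The blow-down radius in the chart `U₂`: `‖(u, u m)‖`. [folklore] -/
theorem bdRad_Φ₂ (p : ℂ × ℂ) : bdRad (Φ₂ p) = ‖fromC2 (p.1, p.1 * p.2)‖ := by
  rw [bdRad, blowDown_Φ₂, discBInv]
  simp

/-- The blow-down radius in the chart `U₃`: `‖(k w, w)‖`. [folklore] -/
theorem bdRad_Φ₃ (p : ℂ × ℂ) : bdRad (Φ₃ p) = ‖fromC2 (p.1 * p.2, p.2)‖ := by
  rw [bdRad, blowDown_Φ₃, discBInv]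
  simp

/-- The blow-down radius is continuous off the south-pole fibre. [folklore] -/
theorem continuousOn_bdRad : ContinuousOn bdRad sFibreᶜ := by
  refine continuous_norm.comp_continuousOn ?_
  refine contMDiffOn_discBInv.continuousOn.comp continuous_blowDown.continuousOn fun v hv => ?_
  exact hv

/-- The set `{bdRad < r} ∖ sFibre` is open. [folklore] -/
theorem isOpen_bdRad_lt (r : ℝ) : IsOpen {v | v ∉ sFibre ∧ bdRad v < r} :=
  continuousOn_bdRad.isOpen_inter_preimage isClosed_sFibre.isOpen_compl isOpen_Iio

/-- The set `{r < bdRad} ∖ sFibre` is open. [folklore] -/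
theorem isOpen_lt_bdRad (r : ℝ) : IsOpen {v | v ∉ sFibre ∧ r < bdRad v} :=
  continuousOn_bdRad.isOpen_inter_preimage isClosed_sFibre.isOpen_compl isOpen_Ioi

/-! ### The squeeze of the model -/

/-- **The squeeze of the model**: `liftDisc v ↦ liftDisc (neckSqueeze v)` off `E` and the
south-pole fibre, the identity on `E` (and junk = identity on the south-pole fibre). [folklore] -/
def squeezeM (v : Model) : Model :=
  open scoped Classical in
  if v ∈ sFibre ∪ excep then v else liftDisc (neckSqueeze (discBInv (blowDown v)))

/-- The inverse squeeze (on `{bdRad < 1/8}`). [folklore] -/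
def unsqueezeM (v : Model) : Model :=
  open scoped Classical in
  if v ∈ sFibre ∪ excep then v else liftDisc (neckSqueezeInv (discBInv (blowDown v)))

/-- `neckSqueezeInv 0 = 0` (in `ℝ⁴`). [folklore] -/
theorem neckSqueezeInv_zero : neckSqueezeInv (0 : 𝔼 4) = 0 := by
  simp [neckSqueezeInv, ballContractionInv, radialMap_zero]

/-- The squeeze fixes the exceptional curve pointwise. [folklore] -/
theorem squeezeM_of_mem_excep {v : Model} (hv : v ∈ excep) : squeezeM v = v := by
  rw [squeezeM, if_pos (mem_union_right sFibre hv)]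

/-- The inverse squeeze fixes the exceptional curve pointwise. [folklore] -/
theorem unsqueezeM_of_mem_excep {v : Model} (hv : v ∈ excep) : unsqueezeM v = v := by
  rw [unsqueezeM, if_pos (mem_union_right sFibre hv)]

/-- **The squeeze in polar coordinates**: `squeezeM (liftDisc v) = liftDisc (neckSqueeze v)`.
[folklore] -/
theorem squeezeM_liftDisc {v : 𝔼 4} (hv : v ≠ 0) : squeezeM (liftDisc v) = liftDisc (neckSqueeze v) := by
  rw [squeezeM, if_neg, blowDown_liftDisc hv, discBInv_discB]
  rintro (h | h)
  · exact liftDisc_not_mem_sFibre hv h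
  · exact liftDisc_not_mem_excep hv h

/-- The inverse squeeze in polar coordinates. [folklore] -/
theorem unsqueezeM_liftDisc {v : 𝔼 4} (hv : v ≠ 0) :
    unsqueezeM (liftDisc v) = liftDisc (neckSqueezeInv v) := by
  rw [unsqueezeM, if_neg, blowDown_liftDisc hv, discBInv_discB]
  rintro (h | h)
  · exact liftDisc_not_mem_sFibre hv h
  · exact liftDisc_not_mem_excep hv h

/-- `neckSqueeze v ≠ 0` for `v ≠ 0`. [folklore] -/
theorem neckSqueeze_ne_zero {v : 𝔼 4} (hv : v ≠ 0) : neckSqueeze v ≠ 0 := fun h =>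
  hv (injective_neckSqueeze (h.trans neckSqueeze_zero.symm))

/-- `neckSqueezeInv y ≠ 0` for `0 < ‖y‖ < 1/8`. [folklore] -/
theorem neckSqueezeInv_ne_zero {y : 𝔼 4} (hy : y ≠ 0) (hy' : ‖y‖ < 8⁻¹) : neckSqueezeInv y ≠ 0 := by
  intro h
  have := congrArg (neckSqueeze : 𝔼 4 → 𝔼 4) h
  rw [neckSqueeze_neckSqueezeInv hy', neckSqueeze_zero] at this
  exact hy this

/-- `unsqueezeM (squeezeM v) = v` off the south-pole fibre. [folklore] -/
theorem unsqueezeM_squeezeM {v : Model} (hv : v ∉ sFibre) : unsqueezeM (squeezeM v) = v := by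
  by_cases hE : v ∈ excep
  · rw [squeezeM_of_mem_excep hE, unsqueezeM_of_mem_excep hE]
  · obtain ⟨h1, h0⟩ := eq_liftDisc_of_not_mem hv hE
    conv_lhs => rw [← h1]
    rw [squeezeM_liftDisc h0, unsqueezeM_liftDisc (neckSqueeze_ne_zero h0), neckSqueezeInv_neckSqueeze,
      h1]

/-- `squeezeM (unsqueezeM v) = v` off the south-pole fibre when `bdRad v < 1/8`. [folklore] -/
theorem squeezeM_unsqueezeM {v : Model} (hv : v ∉ sFibre) (hr : bdRad v < 8⁻¹) :
    squeezeM (unsqueezeM v) = v := by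
  by_cases hE : v ∈ excep
  · rw [unsqueezeM_of_mem_excep hE, squeezeM_of_mem_excep hE]
  · obtain ⟨h1, h0⟩ := eq_liftDisc_of_not_mem hv hE
    have hr' : ‖discBInv (blowDown v)‖ < 8⁻¹ := hr
    conv_lhs => rw [← h1]
    rw [unsqueezeM_liftDisc h0, squeezeM_liftDisc (neckSqueezeInv_ne_zero h0 hr'),
      neckSqueeze_neckSqueezeInv hr', h1]

/-- The squeeze preserves the complement of the south-pole fibre. [folklore] -/
theorem squeezeM_not_mem_sFibre {v : Model} (hv : v ∉ sFibre) : squeezeM v ∉ sFibre := by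
  by_cases hE : v ∈ excep
  · rw [squeezeM_of_mem_excep hE]; exact hv
  · obtain ⟨h1, h0⟩ := eq_liftDisc_of_not_mem hv hE
    rw [← h1, squeezeM_liftDisc h0]
    exact liftDisc_not_mem_sFibre (neckSqueeze_ne_zero h0)

/-- The inverse squeeze preserves the complement of the south-pole fibre (`bdRad < 1/8`).
[folklore] -/
theorem unsqueezeM_not_mem_sFibre {v : Model} (hv : v ∉ sFibre) (hr : bdRad v < 8⁻¹) :
    unsqueezeM v ∉ sFibre := by
  by_cases hE : v ∈ excep
  · rw [unsqueezeM_of_mem_excep hE]; exact hv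
  · obtain ⟨h1, h0⟩ := eq_liftDisc_of_not_mem hv hE
    rw [← h1, unsqueezeM_liftDisc h0]
    exact liftDisc_not_mem_sFibre (neckSqueezeInv_ne_zero h0 hr)

/-- **The squeezed radius**: `bdRad (squeezeM v) = h (bdRad v)` off the south-pole fibre.
[folklore] -/
theorem bdRad_squeezeM {v : Model} (hv : v ∉ sFibre) : bdRad (squeezeM v) = squeezeProfile (bdRad v) := by
  by_cases hE : v ∈ excep
  · rw [squeezeM_of_mem_excep hE, bdRad_of_mem_excep hE, squeezeProfile_zero]
  · obtain ⟨h1, h0⟩ := eq_liftDisc_of_not_mem hv hE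
    conv_lhs => rw [← h1]
    rw [squeezeM_liftDisc h0, bdRad_liftDisc (neckSqueeze_ne_zero h0), norm_neckSqueeze]
    rfl

/-- The squeezed radius is `< 1/8`. [folklore] -/
theorem bdRad_squeezeM_lt {v : Model} (hv : v ∉ sFibre) : bdRad (squeezeM v) < 8⁻¹ := by
  rw [bdRad_squeezeM hv]
  rcases (bdRad_nonneg v).lt_or_eq with h | h
  · have := (squeezeProfile_mem_Ioo h).2; rwa [one_div] at this
  · rw [← h, squeezeProfile_zero]; norm_num

/-! #### The squeeze in the toric charts -/

/-- The chart-`U₂` expression of the squeeze: `(u, m) ↦ (u', m)` with `u'` the first coordinate of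
the squeezed vector `neckSqueeze (u, u m)`. [folklore] -/
def squeezeChart₂ (p : ℂ × ℂ) : ℂ × ℂ := ((toC2 (neckSqueeze (fromC2 (p.1, p.1 * p.2)))).1, p.2)

/-- The chart-`U₃` expression of the squeeze: `(k, w) ↦ (k, w')` with `w'` the second coordinate of
the squeezed vector `neckSqueeze (k w, w)`. [folklore] -/
def squeezeChart₃ (p : ℂ × ℂ) : ℂ × ℂ := (p.1, (toC2 (neckSqueeze (fromC2 (p.1 * p.2, p.2)))).2)

/-- The chart-`U₂` expression of the inverse squeeze. [folklore] -/
def unsqueezeChart₂ (p : ℂ × ℂ) : ℂ × ℂ := ((toC2 (neckSqueezeInv (fromC2 (p.1, p.1 * p.2)))).1, p.2)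

/-- The chart-`U₃` expression of the inverse squeeze. [folklore] -/
def unsqueezeChart₃ (p : ℂ × ℂ) : ℂ × ℂ := (p.1, (toC2 (neckSqueezeInv (fromC2 (p.1 * p.2, p.2)))).2)

/-- A radial map of `ℝ⁴ ≅ ℂ²` multiplies both complex coordinates by the same real factor
`c = φ ‖z‖ / ‖z‖`. [folklore] -/
theorem toC2_radialMap (φ : ℝ → ℝ) (z : 𝔼 4) :
    toC2 (radialMap φ z) = (((φ ‖z‖ * ‖z‖⁻¹ : ℝ) : ℂ) * (toC2 z).1,
      ((φ ‖z‖ * ‖z‖⁻¹ : ℝ) : ℂ) * (toC2 z).2) := by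
  rw [radialMap, toC2_smul]

/-- The `U₂`-polar form: `liftDisc (fromC2 (u, u m)) = Φ₂ (u, m)` for `u ≠ 0`. [folklore] -/
theorem liftDisc_fromC2_mul {u m : ℂ} (hu : u ≠ 0) : liftDisc (fromC2 (u, u * m)) = Φ₂ (u, m) := by
  rw [liftDisc_eq_Φ₂ (by simpa using hu)]
  simp [inv_mul_cancel_left₀ hu]

/-- The `U₃`-polar form: `liftDisc (fromC2 (k w, w)) = Φ₃ (k, w)` for `w ≠ 0`. [folklore] -/
theorem liftDisc_fromC2_mul' {k w : ℂ} (hw : w ≠ 0) : liftDisc (fromC2 (k * w, w)) = Φ₃ (k, w) := by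
  rw [liftDisc_eq_Φ₃ (by simpa using hw)]
  simp [mul_inv_cancel_right₀ hw]

/-- A point `Φ₂ (u, m)` is on `E` iff `u = 0`. [folklore] -/
theorem Φ₂_mem_excep_iff (p : ℂ × ℂ) : Φ₂ p ∈ excep ↔ p.1 = 0 := by
  rw [← bdRad_eq_zero_iff (Φ₂_not_mem_sFibre p), bdRad_Φ₂, norm_eq_zero, fromC2_eq_zero_iff,
    Prod.mk_eq_zero]
  constructor
  · exact fun h => h.1
  · intro h; simp [h]

/-- A point `Φ₃ (k, w)` is on `E` iff `w = 0`. [folklore] -/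
theorem Φ₃_mem_excep_iff (p : ℂ × ℂ) : Φ₃ p ∈ excep ↔ p.2 = 0 := by
  rw [← bdRad_eq_zero_iff (Φ₃_not_mem_sFibre p), bdRad_Φ₃, norm_eq_zero, fromC2_eq_zero_iff,
    Prod.mk_eq_zero]
  constructor
  · exact fun h => h.2
  · intro h; simp [h]

/-- Radial maps which fix `0` act on the chart `U₂` by `(u, m) ↦ (c u, m)`: the general chart
computation behind `squeezeM_Φ₂` and `unsqueezeM_Φ₂`. [folklore] -/
theorem liftDisc_radialMap_fromC2_mul {φ : ℝ → ℝ} {u m : ℂ} (hu : u ≠ 0)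
    (hφ : 0 < φ ‖fromC2 (u, u * m)‖) :
    liftDisc (radialMap φ (fromC2 (u, u * m))) =
      Φ₂ ((toC2 (radialMap φ (fromC2 (u, u * m)))).1, m) := by
  set z := fromC2 (u, u * m) with hz
  have hz0 : z ≠ 0 := by
    rw [hz, Ne, fromC2_eq_zero_iff, Prod.mk_eq_zero]; exact fun h => hu h.1
  set c : ℝ := φ ‖z‖ * ‖z‖⁻¹ with hc
  have hc0 : c ≠ 0 := mul_ne_zero hφ.ne' (inv_ne_zero (norm_ne_zero_iff.2 hz0))
  have hc0' : (c : ℂ) ≠ 0 := ofReal_ne_zero.2 hc0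
  have h1 : toC2 (radialMap φ z) = ((c : ℂ) * u, (c : ℂ) * u * m) := by
    rw [toC2_radialMap, ← hc, hz, toC2_fromC2]; simp [mul_assoc]
  have h2 : radialMap φ z = fromC2 ((c : ℂ) * u, ((c : ℂ) * u) * m) := by
    apply toC2_injective; rw [h1, toC2_fromC2]
  rw [h2, liftDisc_fromC2_mul (mul_ne_zero hc0' hu), ← h2, h1]

/-- Radial maps which fix `0` act on the chart `U₃` by `(k, w) ↦ (k, c w)`. [folklore] -/
theorem liftDisc_radialMap_fromC2_mul' {φ : ℝ → ℝ} {k w : ℂ} (hw : w ≠ 0)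
    (hφ : 0 < φ ‖fromC2 (k * w, w)‖) :
    liftDisc (radialMap φ (fromC2 (k * w, w))) =
      Φ₃ (k, (toC2 (radialMap φ (fromC2 (k * w, w)))).2) := by
  set z := fromC2 (k * w, w) with hz
  have hz0 : z ≠ 0 := by
    rw [hz, Ne, fromC2_eq_zero_iff, Prod.mk_eq_zero]; exact fun h => hw h.2
  set c : ℝ := φ ‖z‖ * ‖z‖⁻¹ with hc
  have hc0 : c ≠ 0 := mul_ne_zero hφ.ne' (inv_ne_zero (norm_ne_zero_iff.2 hz0))
  have hc0' : (c : ℂ) ≠ 0 := ofReal_ne_zero.2 hc0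
  have h1 : toC2 (radialMap φ z) = (k * ((c : ℂ) * w), (c : ℂ) * w) := by
    rw [toC2_radialMap, ← hc, hz, toC2_fromC2]; simp only [Prod.mk.injEq, and_true]; ring
  have h2 : radialMap φ z = fromC2 (k * ((c : ℂ) * w), (c : ℂ) * w) := by
    apply toC2_injective; rw [h1, toC2_fromC2]
  rw [h2, liftDisc_fromC2_mul' (mul_ne_zero hc0' hw), ← h2, h1]

/-- **The squeeze in the chart `U₂`**: `squeezeM (Φ₂ (u, m)) = Φ₂ (squeezeChart₂ (u, m))`, valid
across the exceptional curve `{u = 0}`. [folklore] -/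
theorem squeezeM_Φ₂ (p : ℂ × ℂ) : squeezeM (Φ₂ p) = Φ₂ (squeezeChart₂ p) := by
  obtain ⟨u, m⟩ := p
  by_cases hu : u = 0
  · subst hu
    rw [squeezeM_of_mem_excep ((Φ₂_mem_excep_iff _).2 rfl), squeezeChart₂]
    dsimp only
    rw [zero_mul, Prod.mk_zero_zero, fromC2_zero, neckSqueeze_zero, toC2_zero, Prod.fst_zero]
  · rw [← liftDisc_fromC2_mul hu, squeezeM_liftDisc, neckSqueeze_eq_radialMap,
      liftDisc_radialMap_fromC2_mul hu, squeezeChart₂, ← neckSqueeze_eq_radialMap]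
    · have h0 : fromC2 (u, u * m) ≠ 0 := by
        rw [Ne, fromC2_eq_zero_iff, Prod.mk_eq_zero]; exact fun h => hu h.1
      exact (squeezeProfile_mem_Ioo (norm_pos_iff.2 h0)).1
    · rw [Ne, fromC2_eq_zero_iff, Prod.mk_eq_zero]; exact fun h => hu h.1

/-- **The squeeze in the chart `U₃`**: `squeezeM (Φ₃ (k, w)) = Φ₃ (squeezeChart₃ (k, w))`, valid
across the exceptional curve `{w = 0}`. [folklore] -/
theorem squeezeM_Φ₃ (p : ℂ × ℂ) : squeezeM (Φ₃ p) = Φ₃ (squeezeChart₃ p) := by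
  obtain ⟨k, w⟩ := p
  by_cases hw : w = 0
  · subst hw
    rw [squeezeM_of_mem_excep ((Φ₃_mem_excep_iff _).2 rfl), squeezeChart₃]
    dsimp only
    rw [mul_zero, Prod.mk_zero_zero, fromC2_zero, neckSqueeze_zero, toC2_zero, Prod.snd_zero]
  · rw [← liftDisc_fromC2_mul' hw, squeezeM_liftDisc, neckSqueeze_eq_radialMap,
      liftDisc_radialMap_fromC2_mul' hw, squeezeChart₃, ← neckSqueeze_eq_radialMap]
    · have h0 : fromC2 (k * w, w) ≠ 0 := by
        rw [Ne, fromC2_eq_zero_iff, Prod.mk_eq_zero]; exact fun h => hw h.2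
      exact (squeezeProfile_mem_Ioo (norm_pos_iff.2 h0)).1
    · rw [Ne, fromC2_eq_zero_iff, Prod.mk_eq_zero]; exact fun h => hw h.2

/-- `neckSqueezeInv` is a radial map with positive profile on the punctured ball `B(0, 1/8)`:
`‖neckSqueezeInv y‖ > 0` there. The radial-map form of `neckSqueezeInv`. [folklore] -/
theorem neckSqueezeInv_eq_radialMap (y : 𝔼 4) :
    neckSqueezeInv y = radialMap (fun s => (ballProfileInv (8 * s)) / 4) y := by
  rcases eq_or_ne y 0 with rfl | hy
  · simp [neckSqueezeInv, radialMap_zero, ballContractionInv, radialMap_zero]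
  · have hyn : 0 < ‖y‖ := norm_pos_iff.2 hy
    rw [neckSqueezeInv, ballContractionInv, radialMap, radialMap, norm_smul,
      Real.norm_of_nonneg (by norm_num : (0:ℝ) ≤ 8), smul_smul, smul_smul]
    congr 1
    field_simp

/-- The profile of the inverse squeeze is positive on `(0, 1/8)`. [folklore] -/
theorem ballProfileInv_pos_of {s : ℝ} (hs : 0 < s) (hs' : s < 8⁻¹) : 0 < ballProfileInv (8 * s) / 4 := by
  obtain ⟨ρ, hρ, hρs⟩ := exists_ballProfile_eq (s := 8 * s) ⟨by linarith, by
    calc 8 * s < 8 * 8⁻¹ := by gcongr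
      _ = 1 := by norm_num⟩
  rw [← hρs, ballProfileInv_ballProfile]
  positivity

/-- **The inverse squeeze in the chart `U₂`** (on `bdRad < 1/8`). [folklore] -/
theorem unsqueezeM_Φ₂ {p : ℂ × ℂ} (hr : bdRad (Φ₂ p) < 8⁻¹) :
    unsqueezeM (Φ₂ p) = Φ₂ (unsqueezeChart₂ p) := by
  obtain ⟨u, m⟩ := p
  by_cases hu : u = 0
  · subst hu
    rw [unsqueezeM_of_mem_excep ((Φ₂_mem_excep_iff _).2 rfl), unsqueezeChart₂]
    dsimp only
    rw [zero_mul, Prod.mk_zero_zero, fromC2_zero, neckSqueezeInv_zero, toC2_zero, Prod.fst_zero]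
  · have h0 : fromC2 (u, u * m) ≠ 0 := by
      rw [Ne, fromC2_eq_zero_iff, Prod.mk_eq_zero]; exact fun h => hu h.1
    rw [bdRad_Φ₂] at hr
    rw [← liftDisc_fromC2_mul hu, unsqueezeM_liftDisc h0, neckSqueezeInv_eq_radialMap,
      liftDisc_radialMap_fromC2_mul hu, unsqueezeChart₂, ← neckSqueezeInv_eq_radialMap]
    exact ballProfileInv_pos_of (norm_pos_iff.2 h0) hr

/-- **The inverse squeeze in the chart `U₃`** (on `bdRad < 1/8`). [folklore] -/
theorem unsqueezeM_Φ₃ {p : ℂ × ℂ} (hr : bdRad (Φ₃ p) < 8⁻¹) :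
    unsqueezeM (Φ₃ p) = Φ₃ (unsqueezeChart₃ p) := by
  obtain ⟨k, w⟩ := p
  by_cases hw : w = 0
  · subst hw
    rw [unsqueezeM_of_mem_excep ((Φ₃_mem_excep_iff _).2 rfl), unsqueezeChart₃]
    dsimp only
    rw [mul_zero, Prod.mk_zero_zero, fromC2_zero, neckSqueezeInv_zero, toC2_zero, Prod.snd_zero]
  · have h0 : fromC2 (k * w, w) ≠ 0 := by
      rw [Ne, fromC2_eq_zero_iff, Prod.mk_eq_zero]; exact fun h => hw h.2
    rw [bdRad_Φ₃] at hr
    rw [← liftDisc_fromC2_mul' hw, unsqueezeM_liftDisc h0, neckSqueezeInv_eq_radialMap,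
      liftDisc_radialMap_fromC2_mul' hw, unsqueezeChart₃, ← neckSqueezeInv_eq_radialMap]
    exact ballProfileInv_pos_of (norm_pos_iff.2 h0) hr

/-- The chart-`U₂` squeeze is smooth. [folklore] -/
theorem contDiff_squeezeChart₂ : ContDiff ℝ ∞ squeezeChart₂ := by
  unfold squeezeChart₂
  refine ContDiff.prodMk ?_ contDiff_snd
  exact contDiff_fst.comp (contDiff_toC2.comp (contDiff_neckSqueeze.comp
    (contDiff_fromC2.comp (contDiff_fst.prodMk (contDiff_fst.mul contDiff_snd)))))

/-- The chart-`U₃` squeeze is smooth. [folklore] -/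
theorem contDiff_squeezeChart₃ : ContDiff ℝ ∞ squeezeChart₃ := by
  unfold squeezeChart₃
  refine contDiff_fst.prodMk ?_
  exact contDiff_snd.comp (contDiff_toC2.comp (contDiff_neckSqueeze.comp
    (contDiff_fromC2.comp ((contDiff_fst.mul contDiff_snd).prodMk contDiff_snd))))

/-- The chart-`U₂` inverse squeeze is smooth where `‖(u, u m)‖ < 1/8`. [folklore] -/
theorem contDiffAt_unsqueezeChart₂ {p : ℂ × ℂ} (hp : ‖fromC2 (p.1, p.1 * p.2)‖ < 8⁻¹) :
    ContDiffAt ℝ ∞ unsqueezeChart₂ p := by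
  have hg : ContDiffAt ℝ ∞ (fun q : ℂ × ℂ => fromC2 (q.1, q.1 * q.2)) p :=
    (contDiff_fromC2.comp (contDiff_fst.prodMk (contDiff_fst.mul contDiff_snd))).contDiffAt
  have h2 : ContDiffAt ℝ ∞ (fun q : ℂ × ℂ => neckSqueezeInv (fromC2 (q.1, q.1 * q.2))) p :=
    ContDiffAt.comp (g := neckSqueezeInv) (f := fun q : ℂ × ℂ => fromC2 (q.1, q.1 * q.2)) p
      (contDiffAt_neckSqueezeInv hp) hg
  have h3 : ContDiffAt ℝ ∞ (fun q : ℂ × ℂ => (toC2 (neckSqueezeInv (fromC2 (q.1, q.1 * q.2)))).1) p :=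
    contDiffAt_fst.comp p (contDiff_toC2.contDiffAt.comp p h2)
  exact h3.prodMk contDiffAt_snd

/-- The chart-`U₃` inverse squeeze is smooth where `‖(k w, w)‖ < 1/8`. [folklore] -/
theorem contDiffAt_unsqueezeChart₃ {p : ℂ × ℂ} (hp : ‖fromC2 (p.1 * p.2, p.2)‖ < 8⁻¹) :
    ContDiffAt ℝ ∞ unsqueezeChart₃ p := by
  have hg : ContDiffAt ℝ ∞ (fun q : ℂ × ℂ => fromC2 (q.1 * q.2, q.2)) p :=
    (contDiff_fromC2.comp ((contDiff_fst.mul contDiff_snd).prodMk contDiff_snd)).contDiffAt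
  have h2 : ContDiffAt ℝ ∞ (fun q : ℂ × ℂ => neckSqueezeInv (fromC2 (q.1 * q.2, q.2))) p :=
    ContDiffAt.comp (g := neckSqueezeInv) (f := fun q : ℂ × ℂ => fromC2 (q.1 * q.2, q.2)) p
      (contDiffAt_neckSqueezeInv hp) hg
  have h3 : ContDiffAt ℝ ∞ (fun q : ℂ × ℂ => (toC2 (neckSqueezeInv (fromC2 (q.1 * q.2, q.2)))).2) p :=
    contDiffAt_snd.comp p (contDiff_toC2.contDiffAt.comp p h2)
  exact contDiffAt_fst.prodMk h3

/-- **The squeeze is smooth off the south-pole fibre.** [folklore] -/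
theorem contMDiffAt_squeezeM {v : Model} (hv : v ∉ sFibre) :
    ContMDiffAt 𝓘(ℝ, ℂ × ℂ) 𝓘(ℝ, ℂ × ℂ) ∞ squeezeM v := by
  rcases (not_mem_sFibre_iff v).1 hv with ⟨p, rfl⟩ | ⟨p, rfl⟩
  · exact contMDiffAt_of_comp_isImmersionAt (isSmoothEmbedding_Φ₂.isImmersion.isImmersionAt p)
      isOpenMap_Φ₂ (contMDiff_Φ₂.comp contDiff_squeezeChart₂.contMDiff).contMDiffAt squeezeM_Φ₂
  · exact contMDiffAt_of_comp_isImmersionAt (isSmoothEmbedding_Φ₃.isImmersion.isImmersionAt p)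
      isOpenMap_Φ₃ (contMDiff_Φ₃.comp contDiff_squeezeChart₃.contMDiff).contMDiffAt squeezeM_Φ₃

/-- **The inverse squeeze is smooth on `{bdRad < 1/8}` off the south-pole fibre.** [folklore] -/
theorem contMDiffAt_unsqueezeM {v : Model} (hv : v ∉ sFibre) (hr : bdRad v < 8⁻¹) :
    ContMDiffAt 𝓘(ℝ, ℂ × ℂ) 𝓘(ℝ, ℂ × ℂ) ∞ unsqueezeM v := by
  have ho := isOpen_bdRad_lt (8⁻¹ : ℝ)
  rcases (not_mem_sFibre_iff v).1 hv with ⟨p, rfl⟩ | ⟨p, rfl⟩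
  · -- agree with `Φ₂ ∘ unsqueezeChart₂ ∘ Φ₂⁻¹` near `Φ₂ p`
    have hp : ‖fromC2 (p.1, p.1 * p.2)‖ < 8⁻¹ := by rwa [bdRad_Φ₂] at hr
    have key : ∀ q : ℂ × ℂ, Φ₂ q ∈ {v | v ∉ sFibre ∧ bdRad v < 8⁻¹} →
        unsqueezeM (Φ₂ q) = Φ₂ (unsqueezeChart₂ q) := fun q hq => unsqueezeM_Φ₂ hq.2
    -- restrict to the open set of `q` with small radius
    have hU : IsOpen (Φ₂ ⁻¹' {v | v ∉ sFibre ∧ bdRad v < 8⁻¹}) := ho.preimage contMDiff_Φ₂.continuous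
    have hpU : p ∈ Φ₂ ⁻¹' {v | v ∉ sFibre ∧ bdRad v < 8⁻¹} := ⟨Φ₂_not_mem_sFibre p, hr⟩
    -- the composite `unsqueezeM ∘ Φ₂` is smooth at `p`
    have hg : ContMDiffAt 𝓘(ℝ, ℂ × ℂ) 𝓘(ℝ, ℂ × ℂ) ∞ (unsqueezeM ∘ Φ₂) p := by
      have h1 : ContMDiffAt 𝓘(ℝ, ℂ × ℂ) 𝓘(ℝ, ℂ × ℂ) ∞ (Φ₂ ∘ unsqueezeChart₂) p :=
        contMDiff_Φ₂.contMDiffAt.comp p (contDiffAt_unsqueezeChart₂ hp).contMDiffAt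
      refine h1.congr_of_eventuallyEq ?_
      filter_upwards [hU.mem_nhds hpU] with q hq
      exact key q hq
    exact contMDiffAt_of_comp_isImmersionAt (isSmoothEmbedding_Φ₂.isImmersion.isImmersionAt p)
      isOpenMap_Φ₂ hg (fun _ => rfl)
  · have hp : ‖fromC2 (p.1 * p.2, p.2)‖ < 8⁻¹ := by rwa [bdRad_Φ₃] at hr
    have key : ∀ q : ℂ × ℂ, Φ₃ q ∈ {v | v ∉ sFibre ∧ bdRad v < 8⁻¹} →
        unsqueezeM (Φ₃ q) = Φ₃ (unsqueezeChart₃ q) := fun q hq => unsqueezeM_Φ₃ hq.2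
    have hU : IsOpen (Φ₃ ⁻¹' {v | v ∉ sFibre ∧ bdRad v < 8⁻¹}) := ho.preimage contMDiff_Φ₃.continuous
    have hpU : p ∈ Φ₃ ⁻¹' {v | v ∉ sFibre ∧ bdRad v < 8⁻¹} := ⟨Φ₃_not_mem_sFibre p, hr⟩
    have hg : ContMDiffAt 𝓘(ℝ, ℂ × ℂ) 𝓘(ℝ, ℂ × ℂ) ∞ (unsqueezeM ∘ Φ₃) p := by
      have h1 : ContMDiffAt 𝓘(ℝ, ℂ × ℂ) 𝓘(ℝ, ℂ × ℂ) ∞ (Φ₃ ∘ unsqueezeChart₃) p :=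
        contMDiff_Φ₃.contMDiffAt.comp p (contDiffAt_unsqueezeChart₃ hp).contMDiffAt
      refine h1.congr_of_eventuallyEq ?_
      filter_upwards [hU.mem_nhds hpU] with q hq
      exact key q hq
    exact contMDiffAt_of_comp_isImmersionAt (isSmoothEmbedding_Φ₃.isImmersion.isImmersionAt p)
      isOpenMap_Φ₃ hg (fun _ => rfl)

/-- **The squeeze as an open partial diffeomorphism** `U₂ ∪ U₃ ≅ {bdRad < 1/8} ∩ (U₂ ∪ U₃)` of the
model. [folklore] -/
def squeezePH : OpenPartialHomeomorph Model Model where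
  toFun := squeezeM
  invFun := unsqueezeM
  source := sFibreᶜ
  target := {v | v ∉ sFibre ∧ bdRad v < 8⁻¹}
  map_source' _ hv := ⟨squeezeM_not_mem_sFibre hv, bdRad_squeezeM_lt hv⟩
  map_target' _ hv := unsqueezeM_not_mem_sFibre hv.1 hv.2
  left_inv' _ hv := unsqueezeM_squeezeM hv
  right_inv' _ hv := squeezeM_unsqueezeM hv.1 hv.2
  open_source := isClosed_sFibre.isOpen_compl
  open_target := isOpen_bdRad_lt _
  continuousOn_toFun := fun _ hv => (contMDiffAt_squeezeM hv).continuousAt.continuousWithinAt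
  continuousOn_invFun := fun _ hv =>
    (contMDiffAt_unsqueezeM hv.1 hv.2).continuousAt.continuousWithinAt

/-- `squeezePH` acts as `squeezeM`. [folklore] -/
@[simp] theorem squeezePH_apply (v : Model) : squeezePH v = squeezeM v := rfl

/-- Its inverse acts as `unsqueezeM`. [folklore] -/
@[simp] theorem squeezePH_symm_apply (v : Model) : squeezePH.symm v = unsqueezeM v := rfl

/-- Its source is the complement of the south-pole fibre. [folklore] -/
@[simp] theorem squeezePH_source : squeezePH.source = sFibreᶜ := rfl

/-- Its target is `{bdRad < 1/8}` off the south-pole fibre. [folklore] -/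
@[simp] theorem squeezePH_target : squeezePH.target = {v | v ∉ sFibre ∧ bdRad v < 8⁻¹} := rfl

/-- `squeezePH` is smooth on its source. [folklore] -/
theorem contMDiffOn_squeezePH :
    ContMDiffOn 𝓘(ℝ, ℂ × ℂ) 𝓘(ℝ, ℂ × ℂ) ∞ squeezePH squeezePH.source := fun _ hv =>
  (contMDiffAt_squeezeM hv).contMDiffWithinAt

/-- `squeezePH.symm` is smooth on its target. [folklore] -/
theorem contMDiffOn_squeezePH_symm :
    ContMDiffOn 𝓘(ℝ, ℂ × ℂ) 𝓘(ℝ, ℂ × ℂ) ∞ squeezePH.symm squeezePH.target := fun _ hv =>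
  (contMDiffAt_unsqueezeM hv.1 hv.2).contMDiffWithinAt

end ToricBlowup

end Literature.Topology.FourManifolds
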